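/-
Copyright (c) 2026 the pub-hodgecm-mathlib formalisation cell (harness21).  Prover seat hodgecm-mathlib-LH4-p18 (g4), req620 Track A «(D-RAM) FOUR-FRAME» squad
(STAGE-1b, row (2) of the piece `f_{T₊}`, the (β₂) road (R-36) «PURE-CELL LEDGER»; K6 desk LH4-p16 (g3) WORD #24 (c) «p18: A2-TOP — THE TOP CELL'S LAW AT BOTH FRAMES»), 2026-09-05.
-/
import Summits.HodgeConjecture.HodgeConjecture.Theorems.F0P3cDyRamRowTowerTopCellPerCellValue     -- ★ F1b-top p864859 (LH4-p12 (g9)): `rowTower_topCellDiff_mul_card_eq` (★ K6-0 HEAD′ on the top cell, both parities)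
import Summits.HodgeConjecture.HodgeConjecture.Theorems.F0P3cDyRamRamKFrameClassLetters           -- ★ p864373 (LH4-p19 (g3)): `fgap_of_datum`, `deep_of_datum`, `dich_of_datum`, `exists_flipWitness_of_frame`
import Summits.HodgeConjecture.HodgeConjecture.Theorems.F0P3cDyRamAxisColumnZeroOfFrame            -- ★ (LH4 lineage): `formCongr_one_antidiagonal_three_eq_endoShape_two` (the H-frame's congruence at `P₁ = 1`)
import Literature.NumberTheory.Automorphic.UnitaryLatticeTreeSelfDualTransitiveTwo                 -- ★ Lit: `det_antidiagonal_two`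
import HarnessLib

/-!
# Crux `H413`, line LH4 «(D-RAM) FOUR-FRAME» — STAGE-1b, row (2), the (β₂) road (R-36), K6 assembly A2-TOP: «THE TOP CELL'S LAW AT BOTH FRAMES» — ★ F1b-top p864859 on the top
# cell `(b + 2N, b)` of the live row (`2b + d%2 = m`, `m + 2N = jl`), at the hyperbolic literal `((Φ₂).over E, 1; γ₂, φ, h, f)` and at the anisotropic literal `(diag dg, η; P₁, γ₁, φ′, h′, f′)`

Cell `hodgecm-mathlib` (D-0151), FLOOR 0, crux item H413 = `stmt-HodgeConjecture-24833`, route of record `HCCMUnconditional`; squad F0∕P3c∕LH4; lane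
`--supports stmt-HodgeConjecture-24833 --as helper` (count-neutral; pays NO tier-0 row).  THEOREMS ONLY (no `def`, no instance, no notation, no `sorry`, default heartbeats);
★-only imports; states NO law; ‹CORE›∕‹CORE-ODD›∕(β₂) stay HYPOTHESES.
WHAT.  Two heads, `topCell_law_hyper` and `topCell_law_aniso`: ★ F1b-top `rowTower_topCellDiff_mul_card_eq` at `j := b + 2N` with the general block `(H₂, h_W, P₁; γ₂, φ, h, f)`
specialised to ‹CORE.letter.v1›'s two literals — H: `((StdForm.antidiagonal 2).over E, 1, P₁ := 1; γ₂, φ, h, f)` (frame letter `hΓ : endoGL (γ₂, u) ∈ U(Φ₃)`), A: `(Matrix.diagonal dg, η,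
P₁; γA, φ′, h′, f′)` (`γA` = the letter's `γ₁`, renamed against the chart slope `γ₁`) (frame letters `hA`, `hΓ′`, `σ dg = dg`, `|dg| = 1`, `ση = η`, `|η| = 1`) — the block letters ‹CORE.v1›'s BY NAME, the K6 floor `4d ≤ N₀ ≤ m`, `|u₀₀ − 1| ≤ |ϖ|^{N₀}`,
`|lam − 1| ≤ |jEϖ|^{N₀}` (★ A2's cut), the row `2b + d%2 = m` (BOTH parities), the dyadic letter `h2`, the window `1 ≤ N`, `m + 2N = jl`.  DISCHARGED in-file: the fences
`hmcm hlamn hun` (floor), the class letters `hFgap hdeep₂ hc₀1 hdich hwit` (★ p864373), the cell letters `b < j`, `j + m⋆ ≤ jl`, `j + b + d%2 ≤ jl` (`b ≥ 2d` from the floor), and the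
frame facts (H: ★ `det_antidiagonal_two`, ★ `StdForm.over_map`+`transpose_over`, `map_one`, ★ `formCongr_one_antidiagonal_three_eq_endoShape_two`; A: `Matrix.det_diagonal`+`hdg1`,
`Matrix.diagonal_map`+`diagonal_transpose`+`hdgσ` — as in ★ `row_of_core`).  KEPT VERBATIM as binders (★ F1b-top's bytes at `j := b + 2N`): the TOP-chart letters `hκ₀ hΘκ₀ hκ₀1 hξ
hΘξ hξv hμab hR₀ hγ₀ hα₁σ hγ₁σ hγ₁1 hαγ haff` (so ★ A1-top plugs in by `obtain`) and the digit∕precision letters `Rd hRdσ {r r₀} hRd2 hRd3 hrfloor hrR hr₀ hdeep hrtop` (one cell — no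
refinement transfer).  CONCLUSION per head = ★ F1b-top's conclusion bytes under `[H₂ ↦ (StdForm.antidiagonal 2).over E, h_W ↦ (1 : E), j ↦ b + 2N]` resp. `[H₂ ↦ Matrix.diagonal dg,
h_W ↦ η, γ₂ ↦ γA, φ ↦ φ′, h ↦ h′, f ↦ f′, j ↦ b + 2N]` — the `hlaw` socket of LH4-p08's `topCell_density` ∕ ★ `cellValue_of_perCellLaw`; consumer LH4-p15 (g3)'s A5 BY NAME.
WHAT IS NOT CLAIMED: the top chart (A1-top), the top density (A5-dens), the top identity `htop`, any census law.
HONEST LABEL.  Count-neutral instantiation of ★ pieces; nothing printed is asserted; no census law is stated; `HC_CM` is proved only modulo the 7 printed citations (2 remaining named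
inputs: hLiu418 = `stmt-HodgeConjecture-24832`, h413 = `stmt-HodgeConjecture-24833`) until rung 0 closes.
## References
* [Kottwitz1986BaseChangeUnits] R. E. Kottwitz, *Base change for unit elements of Hecke algebras*, Compositio Math. 60 (1986): §1 pp. 240–241 (signed lattice counts cell by cell).
* [LabesseLanglands1979] J.-P. Labesse, R. P. Langlands, *L-indistinguishability for SL(2)*, Canad. J. Math. 31 (1979): §2 (2.2) p. 9 (κ-signed counts).
* [Rogawski1990] J. D. Rogawski, *Automorphic Representations of Unitary Groups in Three Variables*, Ann. of Math. Stud. 123 (1990): §4.9 Prop. 4.9.1 (b) p. 55.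
* [Serre1979] J.-P. Serre, *Local Fields*, GTM 67 (1979): Ch. V §3 Prop. 5, Cor. 2–3 pp. 84–86; Ch. XV §2.
-/

set_option autoImplicit false

noncomputable section

namespace Summit.HodgeConjecture.HodgeConjecture.Cruxes.H413.F0P3cDyRamTopCellLawFrames

open scoped Valued WithZero Matrix MatrixGroups Classical
open WithZero Finset
open Literature.NumberTheory.Automorphic Literature.NumberTheory.Automorphic.HermitianLattice Literature.NumberTheory.Automorphic.UnitaryLatticeTree
open Literature.NumberTheory.Automorphic.UnitaryThreeFourFrame (IsRamifiedQuadraticDatum normSign)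
open Literature.NumberTheory.Rogawski1990
open Summit.HodgeConjecture.HodgeConjecture.Cruxes.H413.F0P3cDyRamFourFramePieces
open Summit.HodgeConjecture.HodgeConjecture.Cruxes.H413.F0P3cDyRamFourFrameCensusDefs (LatticeInLevel LatticeNearTransvShell)
open Summit.HodgeConjecture.HodgeConjecture.Cruxes.H413.F0P3cDyRamStageOneBDefs (mcOfRecord)
open Summit.HodgeConjecture.HodgeConjecture.Cruxes.H413.F0P3cDyRamToricCensusDefs
open Summit.HodgeConjecture.HodgeConjecture.Cruxes.H413.F0P3cDyRamRowCellOnShell (uniformizer_letters)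
open Summit.HodgeConjecture.HodgeConjecture.Cruxes.H413.F0P3cDyRamRowTowerTopCellPerCellValue (rowTower_topCellDiff_mul_card_eq)
open Summit.HodgeConjecture.HodgeConjecture.Cruxes.H413.F0P3cDyRamRamKFrameClassLetters (fgap_of_datum deep_of_datum dich_of_datum exists_flipWitness_of_frame)
open Summit.HodgeConjecture.HodgeConjecture.Cruxes.H413.F0P3cDyRamAxisColumnZeroOfFrame (formCongr_one_antidiagonal_three_eq_endoShape_two)

variable {E M : Type} [Field E] [Valued E ℤᵐ⁰] [Field M] [Valued M ℤᵐ⁰]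

/-! ## §1 The hyperbolic literal `((Φ₂).over E, 1; γ₂, φ, h, f)` in the identity frame -/

/-- **A2-TOP (H) — «THE TOP CELL'S LAW, HYPERBOLIC LITERAL».**  ‹CORE.v1›'s letters BY NAME + the K6 floor + the row `2b + d%2 = m` + `h2` + the window `1 ≤ N`, `m + 2N = jl`;
★ F1b-top's TOP-chart and digit∕precision letters VERBATIM at `j := b + 2N`.  THEN ★ F1b-top's conclusion at `H₂ := (Φ₂).over E`, `h_W := 1`.
[cite: Kottwitz1986BaseChangeUnits, §1 pp. 240–241] [cite: LabesseLanglands1979, §2 (2.2) p. 9] [cite: Rogawski1990, §4.9 Prop. 4.9.1 (b) p. 55] [cite: Serre1979, Ch. V §3 Cor. 3; Ch. XV §2] -/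
theorem topCell_law_hyper [CompleteSpace E] [IsDiscreteValuationRing 𝒪[E]] [Finite 𝓀[E]] [CompleteSpace M] [Finite 𝓀[M]]
    (σ : E →+* E) (ϖ : E) (d tE : ℕ) (hD : IsRamifiedQuadraticDatum σ ϖ d tE)
    (jE : E →+* M) (ρ Θ : M →+* M) (α lam : M)
    (hρρ : ∀ z, ρ (ρ z) = z) (hvρ : ∀ z, Valued.v (ρ z) = Valued.v z)
    (hjv : ∀ a, Valued.v (jE a) ≤ 1 ↔ Valued.v a ≤ 1) (hjfix : ∀ z : M, ρ z = z ↔ ∃ a, jE a = z) (hΘj : ∀ a, Θ (jE a) = jE (σ a))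
    (hΘΘ : ∀ z, Θ (Θ z) = z) (hΘρ : ∀ z, Θ (ρ z) = ρ (Θ z)) (hvΘ : ∀ z, Valued.v (Θ z) = Valued.v z)
    (hα : ρ α ≠ α) (hα1 : Valued.v α ≤ 1) (hint : ∀ z : M, Valued.v z ≤ 1 → Valued.v ((z - ρ z) / (α - ρ α)) ≤ 1)
    (hΘlam : Θ lam * lam = 1) (hvlam : Valued.v lam = 1) (hU : Valued.v (α - ρ α) = 1) (hτ : Valued.v (α - Θ α) < 1)
    (hσres : ∀ z : M, ρ z = z → Valued.v z ≤ 1 → Valued.v (Θ z - z) < 1)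
    (hDM : IsRamifiedQuadraticDatum Θ (jE ϖ) d tE) (hjiso : ∀ a, Valued.v (jE a) = Valued.v a)
    (hq : Nat.card 𝓀[M] = Nat.card 𝓀[E] ^ 2) (hjpow : ∀ (t : E) (n : ℤ), Valued.v (jE t) = Valued.v (jE ϖ) ^ n ↔ Valued.v t = Valued.v ϖ ^ n)
    (hϖmax : ∀ t : M, ρ t = t → Valued.v t < 1 → Valued.v t ≤ Valued.v (jE ϖ))
    (γ₂ : GL (Fin 2) E) (u : GL (Fin 1) E) (m jl : ℕ) (hm : Valued.v (lam - jE ((u : Matrix (Fin 1) (Fin 1) E) 0 0)) = WithZero.exp (-(m : ℤ)))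
    (hjl : Valued.v ((lam - jE ((u : Matrix (Fin 1) (Fin 1) E) 0 0)) - ρ (lam - jE ((u : Matrix (Fin 1) (Fin 1) E) 0 0))) = WithZero.exp (-(jl : ℤ)))
    (hum : Valued.v (((u : Matrix (Fin 1) (Fin 1) E) 0 0) - 1) ≤ Valued.v (ϖ ^ mstarOfRecord d))
    -- the hyperbolic literal in the identity frame
    (hΓ : endoGL (γ₂, u) ∈ unitaryGroupOfForm σ ((StdForm.antidiagonal 3).over E))
    (φ : (Fin 2 → E) →+ M) (h : M) (hφs : ∀ (c : E) (x : Fin 2 → E), φ (c • x) = jE c * φ x) (hφi : Function.Injective φ) (hφo : Function.Surjective φ)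
    (hφγ : ∀ x, φ ((γ₂ : Matrix (Fin 2) (Fin 2) E).mulVec x) = lam * φ x)
    (hform : ∀ x y, jE (pairing σ ((StdForm.antidiagonal 2).over E) x y) = h * Θ (φ x) * φ y + ρ (h * Θ (φ x) * φ y)) (hΘh : Θ h = h) (hh : h ≠ 0)
    (f : ℕ → ℕ → AddSubgroup M → ℕ)
    (hf : ∀ (b j : ℕ) (Λ : AddSubgroup M) (x₀ : M) (r : E), 1 ≤ b → x₀ ≠ 0 → (∀ x, x ∈ Λ ↔ ∃ z, IsOrd ρ α (jE ϖ ^ j) z ∧ x = x₀ * z) →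
      IsOrd ρ α (jE ϖ ^ j) (dualGen ρ Θ α (jE ϖ ^ j) h x₀) → ¬ IsOrd ρ α (jE ϖ ^ j) (dualGen ρ Θ α (jE ϖ ^ j) h x₀ / jE ϖ) → Valued.v (dualGen ρ Θ α (jE ϖ ^ j) h x₀) = Valued.v (jE ϖ) ^ b →
      (∀ b', (∀ x ∈ Λ, Valued.v (h * Θ x * b' + ρ (h * Θ x * b')) ≤ 1) → (lam - jE ((u : Matrix (Fin 1) (Fin 1) E) 0 0)) * b' ∈ Λ) → IsOrd ρ α (jE ϖ ^ j) lam →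
      jE r = glueUnit ρ Θ α (jE ϖ ^ j) h (jE ϖ) (jE (1 : E)) x₀ b →
      f b j Λ = Nat.card {x : 𝒪[E] ⧸ 𝓂[E] ^ (2 * b) // ∃ u' : 𝒪[E], Ideal.Quotient.mk (𝓂[E] ^ (2 * b)) u' = x ∧ Valued.v ((u' : E) * σ u' - r) ≤ Valued.v (ϖ ^ (2 * b))})
    (hfinLS : ∀ j a, (levelSet ρ Θ α (jE ϖ) h j a).Finite)
    -- the K6 floor (‹CORE.v1›'s `_hNm _hu1N _hlam1` at the fence `N₀`, `4d ≤ N₀`), the row (both parities), the dyadic letter, the window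
    {N₀ : ℕ} (h4d : 4 * d ≤ N₀) (hN₀m : N₀ ≤ m)
    (hu1N : Valued.v (((u : Matrix (Fin 1) (Fin 1) E) 0 0) - 1) ≤ Valued.v (ϖ ^ N₀)) (hlam1 : Valued.v (lam - 1) ≤ Valued.v (jE ϖ ^ N₀))
    (b : ℕ) (hbm : 2 * b + d % 2 = m) (h2 : ¬ IsUnit (2 : 𝒪[E])) {N : ℕ} (hN1 : 1 ≤ N) (hNjl : m + 2 * N = jl)
    -- ★ F1b-top's TOP chart and digit∕precision letters at `j := b + 2N`, VERBATIM
    {κ₀ ξ₀ : M} (hκ₀ : κ₀ + ρ κ₀ = 1) (hΘκ₀ : Θ κ₀ = κ₀) (hκ₀1 : Valued.v κ₀ ≤ 1) (hξ : ρ ξ₀ = -ξ₀) (hΘξ : Θ ξ₀ = ξ₀)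
    (hξv : Valued.v ξ₀ * Valued.v (jE ϖ) ^ jl = Valued.v (jE ϖ) ^ (2 * b + d % 2))
    {μa μb R₀ γ₀ : E} (hμab : lam - jE ((u : Matrix (Fin 1) (Fin 1) E) 0 0) = jE μa + jE μb * α)
    (hR₀ : jE R₀ = α * κ₀ + ρ (α * κ₀)) (hγ₀ : jE γ₀ = ξ₀ * (α - ρ α))
    {α₁ γ₁ : E} (hα₁σ : σ α₁ = α₁) (hγ₁σ : σ γ₁ = γ₁) (hγ₁1 : Valued.v γ₁ ≤ 1)
    (hαγ : ∀ V : E, σ V = V → Valued.v V ≤ 1 → Valued.v (μa + μb * (R₀ + V * γ₀)) = Valued.v ϖ ^ (2 * b + d % 2) → Valued.v (α₁ + γ₁ * V) = 1)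
    (haff : ∀ (T W f : E), σ T = T → Valued.v T = 1 → σ W = W → Valued.v W ≤ 1 → σ f = f →
      Valued.v ((μa + μb * R₀) * ((ϖ * σ ϖ) ^ b)⁻¹ + μb * γ₀ * ((ϖ * σ ϖ) ^ b)⁻¹ * W) = Valued.v ((μa + μb * R₀) * ((ϖ * σ ϖ) ^ b)⁻¹) →
      Valued.v (T * ((μa + μb * R₀) * ((ϖ * σ ϖ) ^ b)⁻¹ + μb * γ₀ * ((ϖ * σ ϖ) ^ b)⁻¹ * W) - f * ((ϖ - σ ϖ) * ((ϖ * σ ϖ) ^ ((d - d % 2) / 2))⁻¹)) ≤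
        Valued.v ϖ ^ mstarOfRecord d → normSign σ f = normSign σ T * normSign σ (α₁ + γ₁ * W))
    -- the digit system and the precision letters
    (Rd : Finset E) (hRdσ : ∀ V ∈ Rd, σ V = V) {r r₀ : ℤᵐ⁰}
    (hRd2 : ∀ V : E, σ V = V → Valued.v V ≤ 1 → ∃ V₀ ∈ Rd, Valued.v (V - V₀) ≤ r)
    (hRd3 : ∀ V ∈ Rd, ∀ V' ∈ Rd, Valued.v (V - V') ≤ r → V = V')
    (hrfloor : Valued.v (jE ϖ) ^ (2 * b) ≤ r * Valued.v ξ₀ * Valued.v (jE ϖ ^ (b + 2 * N) * (α - ρ α)))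
    (hrR : r * Valued.v ξ₀ * Valued.v (jE ϖ ^ (b + 2 * N) * (α - ρ α)) < Valued.v (jE ϖ) ^ b)
    (hr₀ : r * Valued.v ξ₀ * Valued.v (jE ϖ ^ (b + 2 * N) * (α - ρ α)) ≤ r₀ * Valued.v (jE ϖ) ^ b)
    (hdeep : ∀ w : M, ρ w = w → Θ w = w → Valued.v (w - 1) ≤ r₀ → ∃ c : M, ρ c = c ∧ c * Θ c = w)
    (hrtop : r ≤ Valued.v ϖ ^ (2 * d - 1)) :
    (((∑ᶠ Λ ∈ levelSetDep ρ Θ α (jE ϖ) h (b + 2 * N) b (lam - jE ((u : Matrix (Fin 1) (Fin 1) E) 0 0)) ∩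
                      {Λ | ∃ B : Submodule 𝒪[E] (Fin 2 → E), B.toAddSubgroup.map φ = Λ ∧
                        ∃ L₃ : Submodule 𝒪[E] (Fin 3 → E), IsSelfDualLattice σ ϖ (!![((StdForm.antidiagonal 2).over E) 0 0, 0, ((StdForm.antidiagonal 2).over E) 0 1; 0, (1 : E), 0; ((StdForm.antidiagonal 2).over E) 1 0, 0, ((StdForm.antidiagonal 2).over E) 1 1] : Matrix (Fin 3) (Fin 3) E) L₃ ∧
                          L₃ ⊓ LinearMap.ker ((LinearMap.proj (1 : Fin 3) : (Fin 3 → E) →ₗ[E] E).restrictScalars 𝒪[E]) =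
                            B.map ((Matrix.toLin' (!![1, 0; 0, 0; 0, 1] : Matrix (Fin 3) (Fin 2) E)).restrictScalars 𝒪[E]) ∧
                          (∀ c : E, (Pi.single 1 c : Fin 3 → E) ∈ L₃ ↔ Valued.v c ≤ Valued.v ϖ ^ b) ∧
                          (LatticeNearTransvShell ϖ (d % 2) (mstarOfRecord d) ((((endoGL (γ₂, u) : GL (Fin 3) E) : Matrix (Fin 3) (Fin 3) E) - 1)) L₃ ∧
                            {z : E | ∃ y ∈ L₃, Valued.v ((ϖ ^ (mstarOfRecord d))⁻¹ * (z - pairing σ (!![((StdForm.antidiagonal 2).over E) 0 0, 0, ((StdForm.antidiagonal 2).over E) 0 1; 0, (1 : E), 0; ((StdForm.antidiagonal 2).over E) 1 0, 0, ((StdForm.antidiagonal 2).over E) 1 1] : Matrix (Fin 3) (Fin 3) E) y (((((endoGL (γ₂, u) : GL (Fin 3) E) : Matrix (Fin 3) (Fin 3) E) - 1)) *ᵥ y))) ≤ 1} =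
                              valueSetMod σ ϖ (mstarOfRecord d) (xPlus σ ϖ d))}, f b (b + 2 * N) Λ : ℕ) : ℤ) -
                  ((∑ᶠ Λ ∈ levelSetDep ρ Θ α (jE ϖ) h (b + 2 * N) b (lam - jE ((u : Matrix (Fin 1) (Fin 1) E) 0 0)) ∩
                      {Λ | ∃ B : Submodule 𝒪[E] (Fin 2 → E), B.toAddSubgroup.map φ = Λ ∧
                        ∃ L₃ : Submodule 𝒪[E] (Fin 3 → E), IsSelfDualLattice σ ϖ (!![((StdForm.antidiagonal 2).over E) 0 0, 0, ((StdForm.antidiagonal 2).over E) 0 1; 0, (1 : E), 0; ((StdForm.antidiagonal 2).over E) 1 0, 0, ((StdForm.antidiagonal 2).over E) 1 1] : Matrix (Fin 3) (Fin 3) E) L₃ ∧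
                          L₃ ⊓ LinearMap.ker ((LinearMap.proj (1 : Fin 3) : (Fin 3 → E) →ₗ[E] E).restrictScalars 𝒪[E]) =
                            B.map ((Matrix.toLin' (!![1, 0; 0, 0; 0, 1] : Matrix (Fin 3) (Fin 2) E)).restrictScalars 𝒪[E]) ∧
                          (∀ c : E, (Pi.single 1 c : Fin 3 → E) ∈ L₃ ↔ Valued.v c ≤ Valued.v ϖ ^ b) ∧
                          (LatticeNearTransvShell ϖ (d % 2) (mcOfRecord d) ((((endoGL (γ₂, u) : GL (Fin 3) E) : Matrix (Fin 3) (Fin 3) E) - 1)) L₃ ∧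
                            ¬ {z : E | ∃ y ∈ L₃, Valued.v ((ϖ ^ (mstarOfRecord d))⁻¹ * (z - pairing σ (!![((StdForm.antidiagonal 2).over E) 0 0, 0, ((StdForm.antidiagonal 2).over E) 0 1; 0, (1 : E), 0; ((StdForm.antidiagonal 2).over E) 1 0, 0, ((StdForm.antidiagonal 2).over E) 1 1] : Matrix (Fin 3) (Fin 3) E) y (((((endoGL (γ₂, u) : GL (Fin 3) E) : Matrix (Fin 3) (Fin 3) E) - 1)) *ᵥ y))) ≤ 1} =
                              valueSetMod σ ϖ (mstarOfRecord d) (xPlus σ ϖ d))}, f b (b + 2 * N) Λ : ℕ) : ℤ)) *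
        ((Rd.filter (fun V₀ : E => Valued.v (κ₀ + jE V₀ * ξ₀) * Valued.v (jE ϖ ^ (b + 2 * N) * (α - ρ α)) = Valued.v (jE ϖ) ^ b ∧
        ∃ e : M, ρ e = e ∧ e * Θ e = (κ₀ + jE V₀ * ξ₀) * ρ (κ₀ + jE V₀ * ξ₀) / (h * ρ h))).card : ℤ) =
      ((∑ᶠ Λ ∈ levelSetDep ρ Θ α (jE ϖ) h (b + 2 * N) b (lam - jE ((u : Matrix (Fin 1) (Fin 1) E) 0 0)), f b (b + 2 * N) Λ : ℕ) : ℤ) *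
        (normSign σ (-(1 : E)) * ∑ V ∈ (Rd.filter (fun V₀ : E => Valued.v (κ₀ + jE V₀ * ξ₀) * Valued.v (jE ϖ ^ (b + 2 * N) * (α - ρ α)) = Valued.v (jE ϖ) ^ b ∧
        ∃ e : M, ρ e = e ∧ e * Θ e = (κ₀ + jE V₀ * ξ₀) * ρ (κ₀ + jE V₀ * ξ₀) / (h * ρ h))).filter
          (fun V => Valued.v (μa + μb * (R₀ + V * γ₀)) = Valued.v ϖ ^ (2 * b + d % 2)), normSign σ (α₁ + γ₁ * V)) := by
  obtain ⟨-, -, hϖ, -, -, hd1, -⟩ := id hD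
  obtain ⟨-, hϖlt, -, -, -, -, hjϖle⟩ := uniformizer_letters jE hjv hϖ
  -- the FLOOR letters: `m⋆ = d%2 + 2d − 1`, `m_c ≤ 4d ≤ N₀ ≤ m`, hence `b ≥ 2d`
  have hm1 : mstarOfRecord d = d % 2 + 2 * d - 1 := rfl
  have hmc : mcOfRecord d = 2 * ((mstarOfRecord d + d) / 2) := rfl
  have hmcm : mcOfRecord d ≤ m := by rw [hmc, hm1]; omega
  have hlamn : Valued.v (lam - 1) ≤ Valued.v (jE ϖ) ^ mcOfRecord d := by
    refine hlam1.trans ?_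
    rw [Valuation.map_pow]
    exact pow_le_pow_right_of_le_one' hjϖle (by rw [hmc, hm1]; omega)
  have hun : Valued.v ((u : Matrix (Fin 1) (Fin 1) E) 0 0 - 1) ≤ Valued.v ϖ ^ mcOfRecord d := by
    refine hu1N.trans ?_
    rw [Valuation.map_pow]
    exact pow_le_pow_right_of_le_one' hϖlt.le (by rw [hmc, hm1]; omega)
  -- the CLASS letters of the frame (★ p864373)
  have hFgap : ∀ z : M, ρ z = z → Θ z = z → Valued.v (jE ϖ) < Valued.v z → Valued.v z ≤ 1 → Valued.v z = 1 := fgap_of_datum hDM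
  have hdeep₂ : ∀ w : M, ρ w = w → Θ w = w → Valued.v (w - 1) ≤ Valued.v (jE ϖ) ^ (2 * d) → ∃ c : M, ρ c = c ∧ c * Θ c = w :=
    deep_of_datum hD jE hjv hjfix hΘj (by omega)
  obtain ⟨c₀, -, hc₀1, -, hdich⟩ := dich_of_datum hDM
  have hwit : ∃ a : M, Θ a = a ∧ Valued.v a = 1 ∧ ¬ ∃ e : M, ρ e = e ∧ e * Θ e = a * ρ a :=
    exists_flipWitness_of_frame hD jE hjiso hjfix hΘj hρρ hvρ hΘρ hα1 hU hDM hq hσres hτ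
  -- the CELL letters of the top cell `(b + 2N, b)`
  have hbj : b < b + 2 * N := by omega
  have hjm : b + 2 * N + mstarOfRecord d ≤ jl := by rw [hm1]; omega
  have hcell : b + 2 * N + b + d % 2 ≤ jl := by omega
  -- the H-frame facts (as in ★ `row_of_core`)
  have hH₂ : IsUnit ((StdForm.antidiagonal 2).over E).det := by rw [det_antidiagonal_two]; exact isUnit_one.neg
  have hH₂σ : ((((StdForm.antidiagonal 2).over E).map σ))ᵀ = (StdForm.antidiagonal 2).over E := by rw [StdForm.over_map, StdForm.transpose_over]
  have hΓ₁ : (1 : GL (Fin 3) E) * endoGL (γ₂, u) * 1⁻¹ ∈ unitaryGroupOfForm σ ((StdForm.antidiagonal 3).over E) := by rwa [one_mul, inv_one, mul_one]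
  exact rowTower_topCellDiff_mul_card_eq σ ϖ d tE hD jE ρ Θ α lam hρρ hvρ hjv hjfix hΘj hΘΘ hΘρ hvΘ hα hα1 hint hvlam hU hjiso hjpow hϖmax γ₂ u m jl hm hjl hum
    ((StdForm.antidiagonal 2).over E) 1 hH₂ hH₂σ (by rw [Valuation.map_one]) (map_one σ) φ h hφs hφi hφo hφγ hform hΘh hh f hf hfinLS b hbm hΘlam 1
    (formCongr_one_antidiagonal_three_eq_endoShape_two σ) hΓ₁ hmcm hlamn hun hFgap h2 hdeep₂ hc₀1 hdich hwit hbj hjm hκ₀ hΘκ₀ hκ₀1 hξ hΘξ hcell hξv hμab hR₀ hγ₀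
    hα₁σ hγ₁σ hγ₁1 hαγ haff Rd hRdσ hRd2 hRd3 hrfloor hrR hr₀ hdeep hrtop

/-! ## §2 The anisotropic literal `(diag dg, η; P₁, γA, φ′, h′, f′)` (the letter's `γ₁`; renamed here because the chart's slope is `γ₁`) -/

/-- **A2-TOP (A) — «THE TOP CELL'S LAW, ANISOTROPIC LITERAL».**  As §1 with the frame letters `hA`, `hΓ′`, `|dg| = 1`, `σdg = dg`, `ση = η`, `|η| = 1` and the A-literal's line model
`(φ′, h′, f′)`.  THEN ★ F1b-top's conclusion at `H₂ := Matrix.diagonal dg`, `h_W := η`, `γ₂ := γA` (‹CORE.v1›'s `γ₁`).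
[cite: Kottwitz1986BaseChangeUnits, §1 pp. 240–241] [cite: LabesseLanglands1979, §2 (2.2) p. 9] [cite: Rogawski1990, §4.9 Prop. 4.9.1 (b) p. 55] [cite: Serre1979, Ch. V §3 Cor. 3; Ch. XV §2] -/
theorem topCell_law_aniso [CompleteSpace E] [IsDiscreteValuationRing 𝒪[E]] [Finite 𝓀[E]] [CompleteSpace M] [Finite 𝓀[M]]
    (σ : E →+* E) (ϖ : E) (d tE : ℕ) (hD : IsRamifiedQuadraticDatum σ ϖ d tE)
    (jE : E →+* M) (ρ Θ : M →+* M) (α lam : M)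
    (hρρ : ∀ z, ρ (ρ z) = z) (hvρ : ∀ z, Valued.v (ρ z) = Valued.v z)
    (hjv : ∀ a, Valued.v (jE a) ≤ 1 ↔ Valued.v a ≤ 1) (hjfix : ∀ z : M, ρ z = z ↔ ∃ a, jE a = z) (hΘj : ∀ a, Θ (jE a) = jE (σ a))
    (hΘΘ : ∀ z, Θ (Θ z) = z) (hΘρ : ∀ z, Θ (ρ z) = ρ (Θ z)) (hvΘ : ∀ z, Valued.v (Θ z) = Valued.v z)
    (hα : ρ α ≠ α) (hα1 : Valued.v α ≤ 1) (hint : ∀ z : M, Valued.v z ≤ 1 → Valued.v ((z - ρ z) / (α - ρ α)) ≤ 1)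
    (hΘlam : Θ lam * lam = 1) (hvlam : Valued.v lam = 1) (hU : Valued.v (α - ρ α) = 1) (hτ : Valued.v (α - Θ α) < 1)
    (hσres : ∀ z : M, ρ z = z → Valued.v z ≤ 1 → Valued.v (Θ z - z) < 1)
    (hDM : IsRamifiedQuadraticDatum Θ (jE ϖ) d tE) (hjiso : ∀ a, Valued.v (jE a) = Valued.v a)
    (hq : Nat.card 𝓀[M] = Nat.card 𝓀[E] ^ 2) (hjpow : ∀ (t : E) (n : ℤ), Valued.v (jE t) = Valued.v (jE ϖ) ^ n ↔ Valued.v t = Valued.v ϖ ^ n)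
    (hϖmax : ∀ t : M, ρ t = t → Valued.v t < 1 → Valued.v t ≤ Valued.v (jE ϖ))
    (u : GL (Fin 1) E) (m jl : ℕ) (hm : Valued.v (lam - jE ((u : Matrix (Fin 1) (Fin 1) E) 0 0)) = WithZero.exp (-(m : ℤ)))
    (hjl : Valued.v ((lam - jE ((u : Matrix (Fin 1) (Fin 1) E) 0 0)) - ρ (lam - jE ((u : Matrix (Fin 1) (Fin 1) E) 0 0))) = WithZero.exp (-(jl : ℤ)))
    (hum : Valued.v (((u : Matrix (Fin 1) (Fin 1) E) 0 0) - 1) ≤ Valued.v (ϖ ^ mstarOfRecord d))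
    -- the anisotropic literal in the frame `P₁`
    (P₁ : GL (Fin 3) E) (dg : Fin 2 → E) (η : E) (γA : GL (Fin 2) E)
    (hA : formCongr σ P₁ ((StdForm.antidiagonal 3).over E) =
      (!![(Matrix.diagonal dg) 0 0, 0, (Matrix.diagonal dg) 0 1; 0, η, 0; (Matrix.diagonal dg) 1 0, 0, (Matrix.diagonal dg) 1 1] : Matrix (Fin 3) (Fin 3) E))
    (hΓ' : P₁ * endoGL (γA, u) * P₁⁻¹ ∈ unitaryGroupOfForm σ ((StdForm.antidiagonal 3).over E))
    (hdg1 : ∀ i, Valued.v (dg i) = 1) (hdgσ : ∀ i, σ (dg i) = dg i) (hησ : σ η = η) (hη1 : Valued.v η = 1)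
    (φ' : (Fin 2 → E) →+ M) (h' : M) (hφ's : ∀ (c : E) (x : Fin 2 → E), φ' (c • x) = jE c * φ' x) (hφ'i : Function.Injective φ') (hφ'o : Function.Surjective φ')
    (hφ'γ : ∀ x, φ' ((γA : Matrix (Fin 2) (Fin 2) E).mulVec x) = lam * φ' x)
    (hform' : ∀ x y, jE (pairing σ (Matrix.diagonal dg) x y) = h' * Θ (φ' x) * φ' y + ρ (h' * Θ (φ' x) * φ' y)) (hΘh' : Θ h' = h') (hh' : h' ≠ 0)
    (f' : ℕ → ℕ → AddSubgroup M → ℕ)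
    (hf' : ∀ (b j : ℕ) (Λ : AddSubgroup M) (x₀ : M) (r : E), 1 ≤ b → x₀ ≠ 0 → (∀ x, x ∈ Λ ↔ ∃ z, IsOrd ρ α (jE ϖ ^ j) z ∧ x = x₀ * z) →
      IsOrd ρ α (jE ϖ ^ j) (dualGen ρ Θ α (jE ϖ ^ j) h' x₀) → ¬ IsOrd ρ α (jE ϖ ^ j) (dualGen ρ Θ α (jE ϖ ^ j) h' x₀ / jE ϖ) → Valued.v (dualGen ρ Θ α (jE ϖ ^ j) h' x₀) = Valued.v (jE ϖ) ^ b →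
      (∀ b', (∀ x ∈ Λ, Valued.v (h' * Θ x * b' + ρ (h' * Θ x * b')) ≤ 1) → (lam - jE ((u : Matrix (Fin 1) (Fin 1) E) 0 0)) * b' ∈ Λ) → IsOrd ρ α (jE ϖ ^ j) lam →
      jE r = glueUnit ρ Θ α (jE ϖ ^ j) h' (jE ϖ) (jE η) x₀ b →
      f' b j Λ = Nat.card {x : 𝒪[E] ⧸ 𝓂[E] ^ (2 * b) // ∃ u' : 𝒪[E], Ideal.Quotient.mk (𝓂[E] ^ (2 * b)) u' = x ∧ Valued.v ((u' : E) * σ u' - r) ≤ Valued.v (ϖ ^ (2 * b))})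
    (hfinLS' : ∀ j a, (levelSet ρ Θ α (jE ϖ) h' j a).Finite)
    -- the K6 floor (‹CORE.v1›'s `_hNm _hu1N _hlam1` at the fence `N₀`, `4d ≤ N₀`), the row (both parities), the dyadic letter, the window
    {N₀ : ℕ} (h4d : 4 * d ≤ N₀) (hN₀m : N₀ ≤ m)
    (hu1N : Valued.v (((u : Matrix (Fin 1) (Fin 1) E) 0 0) - 1) ≤ Valued.v (ϖ ^ N₀)) (hlam1 : Valued.v (lam - 1) ≤ Valued.v (jE ϖ ^ N₀))
    (b : ℕ) (hbm : 2 * b + d % 2 = m) (h2 : ¬ IsUnit (2 : 𝒪[E])) {N : ℕ} (hN1 : 1 ≤ N) (hNjl : m + 2 * N = jl)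
    -- ★ F1b-top's TOP chart and digit∕precision letters at `j := b + 2N`, VERBATIM
    {κ₀ ξ₀ : M} (hκ₀ : κ₀ + ρ κ₀ = 1) (hΘκ₀ : Θ κ₀ = κ₀) (hκ₀1 : Valued.v κ₀ ≤ 1) (hξ : ρ ξ₀ = -ξ₀) (hΘξ : Θ ξ₀ = ξ₀)
    (hξv : Valued.v ξ₀ * Valued.v (jE ϖ) ^ jl = Valued.v (jE ϖ) ^ (2 * b + d % 2))
    {μa μb R₀ γ₀ : E} (hμab : lam - jE ((u : Matrix (Fin 1) (Fin 1) E) 0 0) = jE μa + jE μb * α)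
    (hR₀ : jE R₀ = α * κ₀ + ρ (α * κ₀)) (hγ₀ : jE γ₀ = ξ₀ * (α - ρ α))
    {α₁ γ₁ : E} (hα₁σ : σ α₁ = α₁) (hγ₁σ : σ γ₁ = γ₁) (hγ₁1 : Valued.v γ₁ ≤ 1)
    (hαγ : ∀ V : E, σ V = V → Valued.v V ≤ 1 → Valued.v (μa + μb * (R₀ + V * γ₀)) = Valued.v ϖ ^ (2 * b + d % 2) → Valued.v (α₁ + γ₁ * V) = 1)
    (haff : ∀ (T W f' : E), σ T = T → Valued.v T = 1 → σ W = W → Valued.v W ≤ 1 → σ f' = f' →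
      Valued.v ((μa + μb * R₀) * ((ϖ * σ ϖ) ^ b)⁻¹ + μb * γ₀ * ((ϖ * σ ϖ) ^ b)⁻¹ * W) = Valued.v ((μa + μb * R₀) * ((ϖ * σ ϖ) ^ b)⁻¹) →
      Valued.v (T * ((μa + μb * R₀) * ((ϖ * σ ϖ) ^ b)⁻¹ + μb * γ₀ * ((ϖ * σ ϖ) ^ b)⁻¹ * W) - f' * ((ϖ - σ ϖ) * ((ϖ * σ ϖ) ^ ((d - d % 2) / 2))⁻¹)) ≤
        Valued.v ϖ ^ mstarOfRecord d → normSign σ f' = normSign σ T * normSign σ (α₁ + γ₁ * W))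
    -- the digit system and the precision letters
    (Rd : Finset E) (hRdσ : ∀ V ∈ Rd, σ V = V) {r r₀ : ℤᵐ⁰}
    (hRd2 : ∀ V : E, σ V = V → Valued.v V ≤ 1 → ∃ V₀ ∈ Rd, Valued.v (V - V₀) ≤ r)
    (hRd3 : ∀ V ∈ Rd, ∀ V' ∈ Rd, Valued.v (V - V') ≤ r → V = V')
    (hrfloor : Valued.v (jE ϖ) ^ (2 * b) ≤ r * Valued.v ξ₀ * Valued.v (jE ϖ ^ (b + 2 * N) * (α - ρ α)))
    (hrR : r * Valued.v ξ₀ * Valued.v (jE ϖ ^ (b + 2 * N) * (α - ρ α)) < Valued.v (jE ϖ) ^ b)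
    (hr₀ : r * Valued.v ξ₀ * Valued.v (jE ϖ ^ (b + 2 * N) * (α - ρ α)) ≤ r₀ * Valued.v (jE ϖ) ^ b)
    (hdeep : ∀ w : M, ρ w = w → Θ w = w → Valued.v (w - 1) ≤ r₀ → ∃ c : M, ρ c = c ∧ c * Θ c = w)
    (hrtop : r ≤ Valued.v ϖ ^ (2 * d - 1)) :
    (((∑ᶠ Λ ∈ levelSetDep ρ Θ α (jE ϖ) h' (b + 2 * N) b (lam - jE ((u : Matrix (Fin 1) (Fin 1) E) 0 0)) ∩
                      {Λ | ∃ B : Submodule 𝒪[E] (Fin 2 → E), B.toAddSubgroup.map φ' = Λ ∧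
                        ∃ L₃ : Submodule 𝒪[E] (Fin 3 → E), IsSelfDualLattice σ ϖ (!![(Matrix.diagonal dg) 0 0, 0, (Matrix.diagonal dg) 0 1; 0, η, 0; (Matrix.diagonal dg) 1 0, 0, (Matrix.diagonal dg) 1 1] : Matrix (Fin 3) (Fin 3) E) L₃ ∧
                          L₃ ⊓ LinearMap.ker ((LinearMap.proj (1 : Fin 3) : (Fin 3 → E) →ₗ[E] E).restrictScalars 𝒪[E]) =
                            B.map ((Matrix.toLin' (!![1, 0; 0, 0; 0, 1] : Matrix (Fin 3) (Fin 2) E)).restrictScalars 𝒪[E]) ∧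
                          (∀ c : E, (Pi.single 1 c : Fin 3 → E) ∈ L₃ ↔ Valued.v c ≤ Valued.v ϖ ^ b) ∧
                          (LatticeNearTransvShell ϖ (d % 2) (mstarOfRecord d) ((((endoGL (γA, u) : GL (Fin 3) E) : Matrix (Fin 3) (Fin 3) E) - 1)) L₃ ∧
                            {z : E | ∃ y ∈ L₃, Valued.v ((ϖ ^ (mstarOfRecord d))⁻¹ * (z - pairing σ (!![(Matrix.diagonal dg) 0 0, 0, (Matrix.diagonal dg) 0 1; 0, η, 0; (Matrix.diagonal dg) 1 0, 0, (Matrix.diagonal dg) 1 1] : Matrix (Fin 3) (Fin 3) E) y (((((endoGL (γA, u) : GL (Fin 3) E) : Matrix (Fin 3) (Fin 3) E) - 1)) *ᵥ y))) ≤ 1} =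
                              valueSetMod σ ϖ (mstarOfRecord d) (xPlus σ ϖ d))}, f' b (b + 2 * N) Λ : ℕ) : ℤ) -
                  ((∑ᶠ Λ ∈ levelSetDep ρ Θ α (jE ϖ) h' (b + 2 * N) b (lam - jE ((u : Matrix (Fin 1) (Fin 1) E) 0 0)) ∩
                      {Λ | ∃ B : Submodule 𝒪[E] (Fin 2 → E), B.toAddSubgroup.map φ' = Λ ∧
                        ∃ L₃ : Submodule 𝒪[E] (Fin 3 → E), IsSelfDualLattice σ ϖ (!![(Matrix.diagonal dg) 0 0, 0, (Matrix.diagonal dg) 0 1; 0, η, 0; (Matrix.diagonal dg) 1 0, 0, (Matrix.diagonal dg) 1 1] : Matrix (Fin 3) (Fin 3) E) L₃ ∧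
                          L₃ ⊓ LinearMap.ker ((LinearMap.proj (1 : Fin 3) : (Fin 3 → E) →ₗ[E] E).restrictScalars 𝒪[E]) =
                            B.map ((Matrix.toLin' (!![1, 0; 0, 0; 0, 1] : Matrix (Fin 3) (Fin 2) E)).restrictScalars 𝒪[E]) ∧
                          (∀ c : E, (Pi.single 1 c : Fin 3 → E) ∈ L₃ ↔ Valued.v c ≤ Valued.v ϖ ^ b) ∧
                          (LatticeNearTransvShell ϖ (d % 2) (mcOfRecord d) ((((endoGL (γA, u) : GL (Fin 3) E) : Matrix (Fin 3) (Fin 3) E) - 1)) L₃ ∧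
                            ¬ {z : E | ∃ y ∈ L₃, Valued.v ((ϖ ^ (mstarOfRecord d))⁻¹ * (z - pairing σ (!![(Matrix.diagonal dg) 0 0, 0, (Matrix.diagonal dg) 0 1; 0, η, 0; (Matrix.diagonal dg) 1 0, 0, (Matrix.diagonal dg) 1 1] : Matrix (Fin 3) (Fin 3) E) y (((((endoGL (γA, u) : GL (Fin 3) E) : Matrix (Fin 3) (Fin 3) E) - 1)) *ᵥ y))) ≤ 1} =
                              valueSetMod σ ϖ (mstarOfRecord d) (xPlus σ ϖ d))}, f' b (b + 2 * N) Λ : ℕ) : ℤ)) *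
        ((Rd.filter (fun V₀ : E => Valued.v (κ₀ + jE V₀ * ξ₀) * Valued.v (jE ϖ ^ (b + 2 * N) * (α - ρ α)) = Valued.v (jE ϖ) ^ b ∧
        ∃ e : M, ρ e = e ∧ e * Θ e = (κ₀ + jE V₀ * ξ₀) * ρ (κ₀ + jE V₀ * ξ₀) / (h' * ρ h'))).card : ℤ) =
      ((∑ᶠ Λ ∈ levelSetDep ρ Θ α (jE ϖ) h' (b + 2 * N) b (lam - jE ((u : Matrix (Fin 1) (Fin 1) E) 0 0)), f' b (b + 2 * N) Λ : ℕ) : ℤ) *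
        (normSign σ (-η) * ∑ V ∈ (Rd.filter (fun V₀ : E => Valued.v (κ₀ + jE V₀ * ξ₀) * Valued.v (jE ϖ ^ (b + 2 * N) * (α - ρ α)) = Valued.v (jE ϖ) ^ b ∧
        ∃ e : M, ρ e = e ∧ e * Θ e = (κ₀ + jE V₀ * ξ₀) * ρ (κ₀ + jE V₀ * ξ₀) / (h' * ρ h'))).filter
          (fun V => Valued.v (μa + μb * (R₀ + V * γ₀)) = Valued.v ϖ ^ (2 * b + d % 2)), normSign σ (α₁ + γ₁ * V)) := by
  obtain ⟨-, -, hϖ, -, -, hd1, -⟩ := id hD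
  obtain ⟨-, hϖlt, -, -, -, -, hjϖle⟩ := uniformizer_letters jE hjv hϖ
  -- the FLOOR letters: `m⋆ = d%2 + 2d − 1`, `m_c ≤ 4d ≤ N₀ ≤ m`, hence `b ≥ 2d`
  have hm1 : mstarOfRecord d = d % 2 + 2 * d - 1 := rfl
  have hmc : mcOfRecord d = 2 * ((mstarOfRecord d + d) / 2) := rfl
  have hmcm : mcOfRecord d ≤ m := by rw [hmc, hm1]; omega
  have hlamn : Valued.v (lam - 1) ≤ Valued.v (jE ϖ) ^ mcOfRecord d := by
    refine hlam1.trans ?_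
    rw [Valuation.map_pow]
    exact pow_le_pow_right_of_le_one' hjϖle (by rw [hmc, hm1]; omega)
  have hun : Valued.v ((u : Matrix (Fin 1) (Fin 1) E) 0 0 - 1) ≤ Valued.v ϖ ^ mcOfRecord d := by
    refine hu1N.trans ?_
    rw [Valuation.map_pow]
    exact pow_le_pow_right_of_le_one' hϖlt.le (by rw [hmc, hm1]; omega)
  -- the CLASS letters of the frame (★ p864373)
  have hFgap : ∀ z : M, ρ z = z → Θ z = z → Valued.v (jE ϖ) < Valued.v z → Valued.v z ≤ 1 → Valued.v z = 1 := fgap_of_datum hDM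
  have hdeep₂ : ∀ w : M, ρ w = w → Θ w = w → Valued.v (w - 1) ≤ Valued.v (jE ϖ) ^ (2 * d) → ∃ c : M, ρ c = c ∧ c * Θ c = w :=
    deep_of_datum hD jE hjv hjfix hΘj (by omega)
  obtain ⟨c₀, -, hc₀1, -, hdich⟩ := dich_of_datum hDM
  have hwit : ∃ a : M, Θ a = a ∧ Valued.v a = 1 ∧ ¬ ∃ e : M, ρ e = e ∧ e * Θ e = a * ρ a :=
    exists_flipWitness_of_frame hD jE hjiso hjfix hΘj hρρ hvρ hΘρ hα1 hU hDM hq hσres hτ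
  -- the CELL letters of the top cell `(b + 2N, b)`
  have hbj : b < b + 2 * N := by omega
  have hjm : b + 2 * N + mstarOfRecord d ≤ jl := by rw [hm1]; omega
  have hcell : b + 2 * N + b + d % 2 ≤ jl := by omega
  -- the A-frame facts (as in ★ `row_of_core`)
  have hH₂ : IsUnit (Matrix.diagonal dg).det := by
    rw [Matrix.det_diagonal]; refine isUnit_iff_ne_zero.2 (Finset.prod_ne_zero_iff.2 fun i _ h0 => ?_)
    have h1 := hdg1 i; rw [h0, map_zero] at h1; exact zero_ne_one h1
  have hH₂σ : ((Matrix.diagonal dg).map σ)ᵀ = Matrix.diagonal dg := by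
    rw [Matrix.diagonal_map (map_zero _), Matrix.diagonal_transpose]; exact congrArg Matrix.diagonal (funext hdgσ)
  exact rowTower_topCellDiff_mul_card_eq σ ϖ d tE hD jE ρ Θ α lam hρρ hvρ hjv hjfix hΘj hΘΘ hΘρ hvΘ hα hα1 hint hvlam hU hjiso hjpow hϖmax γA u m jl hm hjl hum
    (Matrix.diagonal dg) η hH₂ hH₂σ hη1 hησ φ' h' hφ's hφ'i hφ'o hφ'γ hform' hΘh' hh' f' hf' hfinLS' b hbm hΘlam P₁ hA hΓ' hmcm hlamn hun hFgap h2 hdeep₂ hc₀1 hdich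
    hwit hbj hjm hκ₀ hΘκ₀ hκ₀1 hξ hΘξ hcell hξv hμab hR₀ hγ₀ hα₁σ hγ₁σ hγ₁1 hαγ haff Rd hRdσ hRd2 hRd3 hrfloor hrR hr₀ hdeep hrtop

end Summit.HodgeConjecture.HodgeConjecture.Cruxes.H413.F0P3cDyRamTopCellLawFrames

end
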